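import Mathlib
import HarnessLib
import HarnessLib.Audit
import Summits.QuantumFields.Statement
import Summits.QuantumFields.YangMills.Theses.InfiniteVolumeContinuum
import Summits.QuantumFields.YangMills.Theorems.InfiniteVolumeContinuumIVData
import Summits.QuantumFields.YangMills.Theorems.InfiniteVolumeContinuumIVReflectionPositivity
import HarnessLib.Audit.Status.Attr

/-!
Route: OnsetCalibration

DORMANT since 2026-08-28T03:52:43Z (banked conditional certificate R2a-IV ⇐ OnsetFloors ∧ SubOnsetCeilings; K2 23313 awaits E0-class input; director-ym g9 R404(a)) — unstaffed, not closed; items shared with open routes are served there. `ledger route dormant <id> --off` reactivates.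

# Route OnsetCalibration — Calibrate the lattice unit at the onset of the non-triviality floors;
ceilings owed only sub-onset

It suffices to show X = OnsetFloors ∧ SubOnsetCeilings ∧ OnsetVanishes, all stated WITHOUT a unit
map: (K1) at every large β SOME
resolution s ∈ (0,1] carries the two non-triviality floors of the legs currency (Q2(θv,v) ≥ ε and
|Q3(f,g,h)| ≥ ε on all tori of physical
side ≥ Λ₅); (K2) the plane-resolved centred-moment ceilings (C/R⁴)ⁿ of MomentBounds6 hold at every
resolution above which no floor
has switched on (the sub-onset = small-observable-coupling regime, located by the theory itself);
(U) a fixed finite torus freezes as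
β → ∞, so onset resolutions shrink. The Assembly item CALIBRATES a(β) := an onset resolution (choice
+ sSup), derives LowerBounds,
MomentBounds6, a > 0 and a → 0, and then runs the proved supports IVData / IVReflectionPositivity /
E1.stub_ivSigned of route
InfiniteVolumeContinuum by name (a complete Lean proof of the Assembly item, 0 sorry, is attached as
evidence: lineA/GlueDev.lean).
Target = the registered leaf HypercubicOSDataFromInfiniteVolume (rung R2a-IV); no summit is proved
by this line.
Lean: `Summit.QuantumFields.YangMills.Theses.OnsetCalibration.OnsetFloors ∧
Summit.QuantumFields.YangMills.Theses.OnsetCalibration.SubOnsetCeilings ∧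
Summit.QuantumFields.YangMills.Theses.OnsetCalibration.OnsetVanishes`

## Assembly
The Assembly item SubOnsetCeilings → OnsetFloors → OnsetVanishes → leaf is PROVED already
(lineA/GlueDev.lean, about 90 lines, 0
sorry, attached as evidence for the first prover): ε := min ε₁ ε₀; the onset set S(β) = {s ∈ (0,1] :
floors at (ε,β,s)} is nonempty (K1)
and bounded; a(β) := a chosen element of S(β) above sSup S(β)/2 (exists_lt_of_lt_csSup), else 1;
LowerBounds G r a by membership;
MomentBounds6 G r a from K2 since every s' ≥ 2a(β) exceeds sSup S(β); Tendsto a atTop (nhds 0) from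
U; then IVData_holds,
IVReflectionPositivity_holds, isReflectionPositive_of_rpPos, isHermitian_of_isReflectionPositive,
E1.stub_ivSigned verbatim as in
route InfiniteVolumeContinuum. The deciding theorem is closes hA hK2 hK1 hU := hA hK2 hK1 hU.

CLOSES_TARGET: closes rung R2a of QuantumFields: Summit.QuantumFields.YangMills.Theses.InfiniteVolumeContinuum.HypercubicOSDataFromInfiniteVolume (D-0061; not the summit Statement) — the deciding theorem of this route concludes that registered leaf instead of the Statement decl `YangMills` (class rung: servable and labelled, never counted as concluding the summit Statement).

Rationale: WHY THIS LINE. Every listed route to OS data pins the lattice unit by a FORMULA (Bałaban's unit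
exp(sizeLog β 1) in BalabanLadder.UV/UVSeamRec and
InfiniteVolumeContinuum; ξ-units on the IR side in CertificationLength) and therefore owes
asymptotic scaling of that formula plus a seam
between the unit of the floors and the unit of the ceilings. Here the unit is a non-perturbative
RENORMALISATION CONDITION in the sense of
lattice step-scaling (LuscherWeiszWolff1991: the box size L_max at which a finite-volume coupling
reaches a prescribed value;
Luscher2010WilsonFlow: t0 from the flow energy; MontvayMunster1994 sect. 1.7 and 3.4: running
couplings defined non-perturbatively):
a(β) is the coarsest resolution at which the observable two- and three-point couplings Q2, |Q3|
reach ε. Floors then hold by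
construction, a → 0 is a Laplace-principle triviality on ONE fixed torus (the probabilistic input:
freezing of a finite Gibbs measure),
and the only analysis owed is hyperscaling ceilings strictly in the regime where the observable
coupling is still below ε — the
perturbative side of the crossover, with no unit of record, no two-loop asymptotic scaling and no IR
input. The negatives index (U(1)
skewness witness 18944, R18 ultralocality) concerns fixed-coupling or abelian statements; all items
here quantify over simple G in the
SU(2) class and over resolutions tied to β.

RANKED CRUXES. #2 SubOnsetCeilings (crux) — For every SU(2)-class G, every lattice representation
and floor datum (v,f,g,h,Λ₅) there is ε₀ > 0 such that for every live floor level 0 < ε ≤ ε₀ the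
MomentBounds6-ceilings (C/R⁴)ⁿ hold for all large β at every resolution s ∈ (0,1] with no floor on
[2s,1], for collars R·s ≤ ℓ₄ (N32 of the ladder in observable, self-located form). [difficulty:
open-problem] (why it might fail: a sub-onset resolution can still sit inside the crossover:
Q2(θv,v) < ε for ONE smearing pair does not bound the plaquette–plaquette covariance at separations
R ≪ Λ₅/s, so (C/R⁴)ⁿ may fail for small R at s ≈ onset/2.) [Balaban1989LargeFieldII,
MagnenRivasseauSeneor1993, LuscherWeiszWolff1991]
#3 OnsetFloors (crux) — For every SU(2)-class G there are r, a positive-time test v, a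
pairwise-disjoint triple f g h, ε > 0, Λ₅, β₅ such that at every β ≥ β₅ SOME resolution s ∈ (0,1]
carries both floors ε ≤ Q2(θv,v) and ε ≤ |Q3(f,g,h)| on all tori with s·L ≥ Λ₅ (scale-free
non-triviality; implied by BalabanLadder.NT, the shared residual conjunct). [difficulty:
open-problem] (why it might fail: uniformity in L at fixed (β,s) may fail for the SAME test
functions at all β (the floor-carrying shape could drift with β), and |Q3| ≥ ε with the same ε as Q2
forces ε of order g_eff⁶, shrinking the admissible window.) [Balaban1989LargeFieldII,
Chatterjee2016, Seiler1982]
#9 OnsetVanishes (support) — For every datum, ε > 0 and s₀ > 0: for all large β no resolution s ∈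
[s₀,1] carries the floors, because on the fixed torus L₀ = ⌈Λ₅/s₀⌉ the Wilson measure concentrates
on flat configurations (Haar-positive neighbourhoods of the minimum set; Laplace principle), so Q2
on that torus tends to 0 uniformly in s ∈ [s₀,1]. [difficulty: M] [Chatterjee2016,
MontvayMunster1994]

TWO-LAYER PLAN. SubOnsetCeilings ⇐ (pair ceiling at sub-onset resolution: n = 2 with explicit C/R⁴
from a small-observable-coupling cluster expansion) →
(tree-graph domination of n-fold centred plane moments by pair strengths at sub-onset resolution) →
SubOnsetCeilings; foreseen, not filed.

KILL CRITERIA. Refutation of SubOnsetCeilings as typed (e.g. a sub-onset resolution with plaquette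
covariance at R = 1 exceeding any C, uniformly in β)
closes the route (close --reason refuted:SubOnsetCeilings) unless the witness only exploits R small
versus Λ₅/s — then pivot: restate with
a collar window R ≥ R₀. Refutation of OnsetFloors refutes BalabanLadder.NT for the SU(2) class as
well (shared residual) — route moot.
If BalabanLadder.UV + UVSeamRec close, InfiniteVolumeContinuum closes the same leaf and this route
is superseded.

NOT DECOMPOSED YET. The cluster-expansion constants (C, ℓ₄), the choice of ε₀ (how far below the
crossover the ceilings are claimed), the n = 2 versus general n
split of SubOnsetCeilings, and the freezing lemma behind OnsetVanishes (fixed-torus Laplace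
principle) are layer-2 children.

CHEAPEST FALSIFIER. Lattice perturbation theory or existing SU(2) Monte-Carlo tables at β ∈ [2.4,
2.8]: compute Q2(θv,v) for a Gaussian bump pair at
resolutions s = 2^-k and the plaquette–plaquette connected correlator at R = 1..4 at the first
sub-onset k; if C_eff(R)·R⁴ grows with β
at fixed sub-onset status the crux is dead. Not run this session; the instrument row is «plaquette
covariance vs smeared Q2 at matched
resolution» (one SU(2) heat-bath sweep table).

NUMBERS. SU(2): two-loop unit a ~ exp(-(3π²/11)β)·β^(51/121); onset of O(1) Creutz ratios at β ≈
2.2–2.5 for L ≤ 16 (Creutz2022 ch. 9;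
MontvayMunster1994 sect. 3.4). Free-field collar decay of centred plaquette pairs: R^-8 per pair,
i.e. (C/R⁴)² (tree: FBL6 in
LangevinControlUVOSLegsFromFemtoAndGapDefs).

DEFINITION REQUESTS. None: all items are typed over the legs currency (Q2, Q3, torusE, plane,
thetaTest, LatticeRep).

Novelty: Searches (2026-08-27): lit search --hybrid "running coupling defined non-perturbatively
renormalization condition step scaling function lattice" (6 docs:
[corpus:book:montvay1994-quantum-fields-lattice p.139, p.107, p.242], rivasseau1991 p.97, creutz2022
p.62); lit search --hybrid "reference scale t0 Wilson flow scale setting" (5 docs: salmhofer1999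
p.98, montvay1994 p.356); lit galaxy search "step scaling function" --star pdf
([galaxy:pdf:-7521727488544303080] SF running coupling, Hayakawa et al.;
[galaxy:pdf:6302413064958430360] arXiv:1908.04605); lit galaxy search "Schrödinger functional"
--star panama (5 textbook hits, [galaxy:panama:433370790101058] DeGrand–DeTar); in-tree: routes
InfiniteVolumeContinuum, BalabanLadder, CertificationLength, LuscherReduction read (consumers of
LowerBounds / MomentBounds6).
Nearest prior art found: LuscherWeiszWolff1991 (doi:10.1016/0550-3213(91)90298-C) — defines the
running coupling non-perturbatively through a finite-volume renormalisation condition and steps the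
scale by 2 (numerical programme, no constructive claim); in-tree nearest: route
InfiniteVolumeContinuum (same leaf; unit = Bałaban's uRec via UV + UVSeamRec).
Delta: the renormalisation-condition idea becomes the DEFINITION of the lattice unit inside a
constructive OS-data statement, which removes the unit-of-record / asymptotic-scaling / seam
obligations of every listed route and confines the ceilings to the self-located sub-onset regime; no
listed route or found paper states  [refs: 10.1016/0550-3213(91, 1908.04605, book:montvay1994-quantum-fields-lattice, doi:10.1016/0550-3213, LuscherWeiszWolff1991]

Barriers (technique_class: scale-setting, renorm-condition, cluster-expansion, laplace): - technique_class: scale-setting, renorm-condition, cluster-expansion, laplace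
- Literature.Barriers.QuantumFields.PerturbativeInvisibility: evaded — no quantity is asserted
through its perturbative series; the unit is defined by a non-perturbative condition on Q2/|Q3| and
a → 0 comes from freezing of a fixed torus, not from a β-function.
- Literature.Barriers.QuantumFields.FixedCouplingUltralocality: outside its class — no item is a
fixed-β, L → ∞ statement about a continuum limit at fixed coupling; resolutions are tied to β
through the onset and Λ₅ ≤ s·L bounds physical volumes below only.
- Literature.Barriers.QuantumFields.UVStabilityNonUniqueness: the bet is that OS data along ONE
calibrated subsequence suffice for the leaf (the leaf is existential in r, a, β_k, μ_k); uniqueness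
of the limit is not claimed.
- Literature.Barriers.QuantumFields.ScalarPhi4Triviality: not in scope (non-abelian simple G;
triviality would contradict OnsetFloors, which is exactly the shared NT conjunct, declared
residual).
- Literature.Barriers.QuantumFields.InfraredRenormalons: outside its class — no
OPE/perturbative-series statement; Q2, Q3 and the moment ceilings are exact lattice expectations at
sub-onset resolutions, and the calibration never invokes a coupling expansion of a(β).
- Literature.Barriers.QuantumFields.ToronPlaneAnticorrelation: outside its class — no sign of a
plaquette covariance is asserted (SubOnsetCeilings bounds |centred moments| two-sidedly; OnsetFloors
concerns the ref

History (route lifecycle, newest last):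
- 2026-08-28T03:52:43Z · DORMANT — banked conditional certificate R2a-IV ⇐ OnsetFloors ∧ SubOnsetCeilings; K2 23313 awaits E0-class input; director-ym g9 R404(a) (operator:999:1789840)

sub-problem: YangMills · status: dormant · opened planner-ym-idea-5-g2-0 2026-08-27T23:08:39Z · rev 1 · ledger route-QuantumFields-OnsetCalibration
GENERATED by the gate from the ledger (D-0016/17). Provers cite these decls: `theorem foo : Summit.QuantumFields.YangMills.Theses.OnsetCalibration.<Decl> := …` in Summits/QuantumFields/YangMills/Theorems/<Name>.lean.
-/

namespace Summit.QuantumFields.YangMills.Theses.OnsetCalibration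

open scoped BigOperators Topology Manifold Classical MeasureTheory ProbabilityTheory Matrix InnerProductSpace ComplexConjugate ContinuousMap
open Filter Set Function TopologicalSpace MeasureTheory

attribute [summit_statement] _root_.YangMills
attribute [summit_statement] _root_.Summit.QuantumFields.YangMills.Theses.InfiniteVolumeContinuum.HypercubicOSDataFromInfiniteVolume

/-- item stmt-QuantumFields-23313 · crux · rank 2 · open · by planner
why it might fail: a sub-onset resolution can still sit inside the crossover: Q2(θv,v) < ε for ONE smearing pair does not bound the plaquette–plaquette covariance at separations R ≪ Λ₅/s, so (C/R⁴)ⁿ may fail for small R at s ≈ onset/2.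
sources: Balaban1989LargeFieldII, MagnenRivasseauSeneor1993, LuscherWeiszWolff1991
[crux] For every SU(2)-class G, every lattice representation and floor datum (v,f,g,h,Λ₅) there is
ε₀ > 0 such that for every live floor level 0 < ε ≤ ε₀ the MomentBounds6-ceilings (C/R⁴)ⁿ hold for
all large β at every resolution s ∈ (0,1] with no floor on [2s,1], for collars R·s ≤ ℓ₄ (N32 of the
ladder in observable, self-located form). [difficulty: open-problem] -/
@[route_item "route-QuantumFields-OnsetCalibration", crux]
def SubOnsetCeilings : Prop :=
  open Literature.MathematicalPhysics.QuantumFieldTheory Literature.MathematicalPhysics.QuantumLattice Summit.QuantumFields.YangMills.Cruxes.OSLegsFromFemtoAndGap.DlrCollarTransfer in ∀ (G : Type) [Group G] [TopologicalSpace G] [IsTopologicalGroup G] [CompactSpace G], IsCompactSimpleLieGroup G → Nonempty (G ≃ₜ* Matrix.specialUnitaryGroup (Fin 2) ℂ) → letI : MeasurableSpace G := borel G; haveI : BorelSpace G := ⟨rfl⟩; ∀ (r : LatticeRep G) (v f g h : SchwartzMap (EuclideanSpace ℝ (Fin 4)) ℝ) (Λ₅ : ℝ), ∃ ε₀ : ℝ,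 0 < ε₀ ∧ ∀ ε : ℝ, 0 < ε → ε ≤ ε₀ → (∃ β₅ : ℝ, ∀ β : ℝ, β₅ ≤ β → ∃ s : ℝ, 0 < s ∧ s ≤ 1 ∧ (∀ L : ℕ, Λ₅ ≤ s * L → ε ≤ Q2 G r β L s (thetaTest 4 v) v) ∧ (∀ L : ℕ, Λ₅ ≤ s * L → ε ≤ |Q3 G r β L s f g h|)) → ∃ (C ℓ₄ β₄ : ℝ), 0 < ℓ₄ ∧ 0 ≤ C ∧ ∀ β : ℝ, β₄ ≤ β → ∀ s : ℝ, 0 < s → s ≤ 1 → (∀ s' : ℝ, 2 * s ≤ s' → s' ≤ 1 → ¬ ((∀ L : ℕ, Λ₅ ≤ s' * L → ε ≤ Q2 G r β L s' (thetaTest 4 v) v) ∧ (∀ L : ℕ, Λ₅ ≤ s' * L → ε ≤ |Q3 G r β L s' f g h|))) → ∀ (L n : ℕ) (q : Fin n → Fin 4 × Fin 4) (x : Fin n → (Fin 4 → ℤ)) (R : ℕ), (∀ i, (q i).1 < (q i).2) → 1 ≤ R → (R : ℝ) * s ≤ ℓ₄ → 4 * R + 8 ≤ L → (∀ i j : Fin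 n, i ≠ j → ∃ k : Fin 4, (2 * (R : ℤ) + 4) ≤ |((((x i k - x j k : ℤ) : ZMod (2 * L + 1))).valMinAbs : ℤ)|) → |torusE G r β L (fun U => ∏ i, (plane G r (q i) (x i) U - torusE G r β L (plane G r (q i) (x i))))| ≤ (C / (R : ℝ) ^ 4) ^ n

/-- item stmt-QuantumFields-23314 · crux · rank 3 · open · by planner
why it might fail: uniformity in L at fixed (β,s) may fail for the SAME test functions at all β (the floor-carrying shape could drift with β), and |Q3| ≥ ε with the same ε as Q2 forces ε of order g_eff⁶, shrinking the admissible window.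
sources: Balaban1989LargeFieldII, Chatterjee2016, Seiler1982
[crux] For every SU(2)-class G there are r, a positive-time test v, a pairwise-disjoint triple f g
h, ε > 0, Λ₅, β₅ such that at every β ≥ β₅ SOME resolution s ∈ (0,1] carries both floors ε ≤
Q2(θv,v) and ε ≤ |Q3(f,g,h)| on all tori with s·L ≥ Λ₅ (scale-free non-triviality; implied by
BalabanLadder.NT, the shared residual conjunct). [difficulty: open-problem] -/
@[route_item "route-QuantumFields-OnsetCalibration", crux]
def OnsetFloors : Prop :=
  open Literature.MathematicalPhysics.QuantumFieldTheory Literature.MathematicalPhysics.QuantumLattice Summit.QuantumFields.YangMills.Cruxes.OSLegsFromFemtoAndGap.DlrCollarTransfer in ∀ (G : Type) [Group G] [TopologicalSpace G] [IsTopologicalGroup G] [CompactSpace G], IsCompactSimpleLieGroup G → Nonempty (G ≃ₜ* Matrix.specialUnitaryGroup (Fin 2) ℂ) → letI : MeasurableSpace G := borel G; haveI : BorelSpace G := ⟨rfl⟩; ∃ (r : LatticeRep G) (v f g h : SchwartzMap (EuclideanSpace ℝ (Fin 4)) ℝ) (ε Λ₅ β₅ : ℝ), tsupport v ⊆ {y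 : EuclideanSpace ℝ (Fin 4) | 0 < y 0} ∧ Disjoint (tsupport f) (tsupport g) ∧ Disjoint (tsupport g) (tsupport h) ∧ Disjoint (tsupport f) (tsupport h) ∧ 0 < ε ∧ ∀ β : ℝ, β₅ ≤ β → ∃ s : ℝ, 0 < s ∧ s ≤ 1 ∧ (∀ L : ℕ, Λ₅ ≤ s * L → ε ≤ Q2 G r β L s (thetaTest 4 v) v) ∧ (∀ L : ℕ, Λ₅ ≤ s * L → ε ≤ |Q3 G r β L s f g h|)

/-- item stmt-QuantumFields-23315 · support · rank 9 · closed · proved by Summit.QuantumFields.YangMills.Theorems.OnsetCalibration.onsetVanishes_proof (prover) · by planner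
sources: Chatterjee2016, MontvayMunster1994
[support] For every datum, ε > 0 and s₀ > 0: for all large β no resolution s ∈ [s₀,1] carries the
floors, because on the fixed torus L₀ = ⌈Λ₅/s₀⌉ the Wilson measure concentrates on flat
configurations (Haar-positive neighbourhoods of the minimum set; Laplace principle), so Q2 on that
torus tends to 0 uniformly in s ∈ [s₀,1]. [difficulty: M] -/
@[route_item "route-QuantumFields-OnsetCalibration", crux]
def OnsetVanishes : Prop :=
  open Literature.MathematicalPhysics.QuantumFieldTheory Literature.MathematicalPhysics.QuantumLattice Summit.QuantumFields.YangMills.Cruxes.OSLegsFromFemtoAndGap.DlrCollarTransfer in ∀ (G : Type) [Group G] [TopologicalSpace G] [IsTopologicalGroup G] [CompactSpace G], IsCompactSimpleLieGroup G → Nonempty (G ≃ₜ* Matrix.specialUnitaryGroup (Fin 2) ℂ) → letI : MeasurableSpace G := borel G; haveI : BorelSpace G := ⟨rfl⟩; ∀ (r : LatticeRep G) (v f g h : SchwartzMap (EuclideanSpace ℝ (Fin 4)) ℝ) (ε Λ₅ s₀ : ℝ), 0 < ε → 0 < s₀ → ∃ β₁ : ℝ, ∀ β : ℝ, β₁ ≤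 β → ∀ s : ℝ, s₀ ≤ s → s ≤ 1 → ¬ ((∀ L : ℕ, Λ₅ ≤ s * L → ε ≤ Q2 G r β L s (thetaTest 4 v) v) ∧ (∀ L : ℕ, Λ₅ ≤ s * L → ε ≤ |Q3 G r β L s f g h|))

-- `OnsetVanishes` holds: proved by `Summit.QuantumFields.YangMills.Theorems.OnsetCalibration.onsetVanishes_proof` (its module imports this route file, so no `_holds` link can be stated here).

/-- item stmt-QuantumFields-23316 · assembly · rank 1 · closed · proved by Summit.QuantumFields.YangMills.Theorems.OnsetCalibration.assembly_proof (prover) · by planner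
sources: LuscherWeiszWolff1991
[assembly] SubOnsetCeilings → OnsetFloors → OnsetVanishes → the leaf
HypercubicOSDataFromInfiniteVolume (proved in lineA/GlueDev.lean; to be landed by the first prover). -/
@[route_item "route-QuantumFields-OnsetCalibration", crux]
def Assembly : Prop :=
  SubOnsetCeilings → OnsetFloors → OnsetVanishes → Summit.QuantumFields.YangMills.Theses.InfiniteVolumeContinuum.HypercubicOSDataFromInfiniteVolume

-- `Assembly` holds: proved by `Summit.QuantumFields.YangMills.Theorems.OnsetCalibration.assembly_proof` (its module imports this route file, so no `_holds` link can be stated here).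

/-! D-0027 §2.1 — DECIDING THEOREM (planner-authored via `route open/edit --closes-file`; by planner-ym-idea-5-g2-0 2026-08-27T23:08:40Z):
its hypotheses are this route's items and its conclusion the registered leaf `Summit.QuantumFields.YangMills.Theses.InfiniteVolumeContinuum.HypercubicOSDataFromInfiniteVolume` (rung R2a, D-0061) (glue_lint), and it elaborates with this file. -/

@[closes "route-QuantumFields-OnsetCalibration"] theorem closes (hA : Summit.QuantumFields.YangMills.Theses.OnsetCalibration.Assembly)
    (hK2 : Summit.QuantumFields.YangMills.Theses.OnsetCalibration.SubOnsetCeilings)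
    (hK1 : Summit.QuantumFields.YangMills.Theses.OnsetCalibration.OnsetFloors)
    (hU : Summit.QuantumFields.YangMills.Theses.OnsetCalibration.OnsetVanishes) :
    Summit.QuantumFields.YangMills.Theses.InfiniteVolumeContinuum.HypercubicOSDataFromInfiniteVolume :=
  -- rung R2a-IV (hypercubic OS data, SU(2) class) — a LEAF of route InfiniteVolumeContinuum, not the summit; no summit is proved by
  -- this line. The Assembly item (calibration of the unit at the onset + the proved IV supports) has a complete proof attached as evidence.
  hA hK2 hK1 hU

end Summit.QuantumFields.YangMills.Theses.OnsetCalibration
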